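import Summits.ResolutionOfSingularities.ResolutionOfSingularities.Theorems.WildQuotientsWildQuotientResolutionToricChartRegular
import HarnessLib

/-!
# TORIC CHART CERTIFICATES — preliminaries for the SINGULAR-CHART PRESENTATION THEOREM (`…ToricChartPresentation`)
# (crux `FInjectiveMacaulayfication` stmt-ResolutionOfSingularities-15315, chain w45a, door v41.1; res-L1-w45a-plan-1 RULING R23.7 (B-L); seat res-L1-w45a-lead-1 g12)

[OURS · L1 W4.5a] Support file (`--supports stmt-ResolutionOfSingularities-15315 --as helper`); replaces the role of NO printed item; NOT a statement of any manuscript;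
def-free; UNCONDITIONAL; no named fact. AI-written (AI review is weaker than expert review).

Context-free plumbing split off the presentation theorem (file-size rule):
* `toLaurent_injective` — `k[x] ↪ k[x^{±1}]`; `lift_injective_of_injective` — lifts of injective maps to localisations are injective;
* `algebraMap_mul_invSelf_pow_eq` (+ `_zero`, `_one`) — fraction bookkeeping `x·b^f = y·b^e ⟹ x/b^e = y/b^f` in `A[1/b]`;
* `theta_prod_pow_mul_wordElem`, `theta_prod_pow_prod_pow` — `θ` of products of powers of word elements is the monomial of the summed exponent;
* `sum_nsmul_single_eq`, `sum_nsmul_sum_zsmul_single` — exponent-vector identities in `ℤ^{Fin d ⊕ P}`;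
* ★ `linearCombination_img_injective` — the lattice map `e′_{s′} ↦ Σ_t ELL t s′ · e_t`, `e′_p ↦ e_p` is injective when `Binv · ELL = det · 1`, `det ≠ 0`
  (coordinate functionals; no determinants).
[folklore]
-/

-- single-problem summit: the doubled namespace component is forced
set_option linter.dupNamespace false

noncomputable section

namespace Summit.ResolutionOfSingularities.ResolutionOfSingularities.Theorems.FInjectiveMacaulayfication.ToricChartPresentation

open MvPolynomial IsLocalization
open Summit.ResolutionOfSingularities.ResolutionOfSingularities.Theorems.WildQuotientResolution
open Summit.ResolutionOfSingularities.ResolutionOfSingularities.Theorems.WildQuotientResolution.ToricChart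

variable {k : Type} [Field k] {P : Type}

/-! ## §1 Injectivity plumbing -/

/-- `k[x] → k[x^{±1}]` is injective. [folklore] -/
theorem toLaurent_injective (V : Type) : Function.Injective (toLaurent k V) := by
  classical
  refine aeval_laurentMonomial_injective (k := k) (fun v : V => Finsupp.single v (1 : ℤ)) ?_
  intro e e' h
  have key : ∀ f : V →₀ ℕ, (f.sum fun v n => (n : ℤ) • Finsupp.single v (1 : ℤ)) = f.mapRange (Nat.cast : ℕ → ℤ) (by simp) := by
    intro f
    ext w
    rw [Finsupp.mapRange_apply, Finsupp.sum_apply, Finsupp.sum]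
    simp only [Finsupp.smul_apply, Finsupp.single_apply, smul_eq_mul, mul_ite, mul_one, mul_zero]
    rw [Finset.sum_ite_eq']
    split_ifs with hw
    · rfl
    · rw [Finsupp.notMem_support_iff.mp hw, Nat.cast_zero]
  have h' : e.mapRange (Nat.cast : ℕ → ℤ) (by simp) = e'.mapRange (Nat.cast : ℕ → ℤ) (by simp) := by rw [← key, ← key]; exact h
  ext w
  have := DFunLike.congr_fun h' w
  simpa using this

/-- A lift `S⁻¹A → B` of an injective `g : A → B` with `g(S) ⊆ Bˣ` is injective. [folklore] -/
theorem lift_injective_of_injective {A B L : Type} [CommRing A] [CommRing B] [CommRing L] [Algebra A L] (M : Submonoid A)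
    [IsLocalization M L] {g : A →+* B} (hg : ∀ y : M, IsUnit (g y)) (hinj : Function.Injective g) :
    Function.Injective (IsLocalization.lift (S := L) hg) := by
  rw [injective_iff_map_eq_zero]
  intro z hz
  obtain ⟨⟨a, s⟩, rfl⟩ := IsLocalization.mk'_surjective M z
  rw [IsLocalization.lift_mk'] at hz
  have ha : g a = 0 := (Units.mul_left_eq_zero _).mp hz
  have ha0 : a = 0 := hinj (by rw [ha, map_zero])
  simp only [ha0, IsLocalization.mk'_zero]

/-! ## §2 Fractions in `A[1/b]` -/

/-- In `A[1/b]`: `x·b^f = y·b^e ⟹ x·(1/b)^e = y·(1/b)^f`. [folklore] -/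
theorem algebraMap_mul_invSelf_pow_eq {A : Type} [CommRing A] (b : A) {L : Type} [CommRing L] [Algebra A L] [IsLocalization.Away b L]
    (x y : A) (e f : ℕ) (h : x * b ^ f = y * b ^ e) :
    algebraMap A L x * IsLocalization.Away.invSelf b ^ e = algebraMap A L y * IsLocalization.Away.invSelf b ^ f := by
  have hinv : algebraMap A L b * IsLocalization.Away.invSelf b = 1 := IsLocalization.Away.mul_invSelf b
  calc algebraMap A L x * IsLocalization.Away.invSelf b ^ e
        = algebraMap A L x * IsLocalization.Away.invSelf b ^ e * (algebraMap A L b * IsLocalization.Away.invSelf b) ^ f := by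
          rw [hinv, one_pow, mul_one]
    _ = algebraMap A L (x * b ^ f) * IsLocalization.Away.invSelf b ^ (e + f) := by rw [map_mul, map_pow]; ring
    _ = algebraMap A L (y * b ^ e) * IsLocalization.Away.invSelf b ^ (e + f) := by rw [h]
    _ = algebraMap A L y * IsLocalization.Away.invSelf b ^ f * (algebraMap A L b * IsLocalization.Away.invSelf b) ^ e := by
          rw [map_mul, map_pow]; ring
    _ = algebraMap A L y * IsLocalization.Away.invSelf b ^ f := by rw [hinv, one_pow, mul_one]

/-- In `A[1/b]`: `x = y·b^e ⟹ x·(1/b)^e = y`. [folklore] -/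
theorem algebraMap_mul_invSelf_pow_eq_zero {A : Type} [CommRing A] (b : A) {L : Type} [CommRing L] [Algebra A L] [IsLocalization.Away b L]
    (x y : A) (e : ℕ) (h : x = y * b ^ e) :
    algebraMap A L x * IsLocalization.Away.invSelf b ^ e = algebraMap A L y := by
  have h' := algebraMap_mul_invSelf_pow_eq b (L := L) x y e 0 (by rw [pow_zero, mul_one, h])
  rwa [pow_zero, mul_one] at h'

/-- In `A[1/b]`: `x·b = y·b^e ⟹ x·(1/b)^e = y·(1/b)`. [folklore] -/
theorem algebraMap_mul_invSelf_pow_eq_one {A : Type} [CommRing A] (b : A) {L : Type} [CommRing L] [Algebra A L] [IsLocalization.Away b L]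
    (x y : A) (e : ℕ) (h : x * b = y * b ^ e) :
    algebraMap A L x * IsLocalization.Away.invSelf b ^ e = algebraMap A L y * IsLocalization.Away.invSelf b := by
  have h' := algebraMap_mul_invSelf_pow_eq b (L := L) x y e 1 (by rw [pow_one, h])
  rwa [pow_one] at h'

/-! ## §3 `θ` of products of powers of word elements -/

/-- `θ((∏_l wordElem(G l)^{n l}) · wordElem w) = x^{Σ_l n l · wordExp(G l) + wordExp w}`. [OURS] -/
theorem theta_prod_pow_mul_wordElem {d r : ℕ} (D : ConeDatum d r) {m : ℕ} (G : Fin m → Word d r) (n : Fin m → ℕ) (w : Word d r) :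
    theta (k := k) (P := P) (D := D) ((∏ l : Fin m, wordElem k P D (G l) ^ n l) * wordElem k P D w) =
      xmon k P (fun t => (fsum m fun l => n l * wordExp D (G l) t) + wordExp D w t) := by
  rw [map_mul, map_prod, theta_wordElem]
  simp only [map_pow, theta_wordElem]
  rw [prod_xmon_pow, ← xmon_add]
  congr 1
  funext t
  simp only [Pi.add_apply, Finset.sum_apply, Pi.smul_apply, smul_eq_mul, fsum_eq_sum]

/-- `θ((∏ a^{wp}) · ∏ b^{wm}) = x^{Σ wp·ea + Σ wm·eb}` when `θ a_{s′} = x^{ea s′}`, `θ b_{j′} = x^{eb j′}`. [OURS] -/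
theorem theta_prod_pow_prod_pow {d r : ℕ} (D : ConeDatum d r) {d' r' : ℕ} (a : Fin d' → Ring k P D) (b : Fin r' → Ring k P D)
    (ea : Fin d' → Fin d → ℕ) (eb : Fin r' → Fin d → ℕ)
    (ha : ∀ s', theta (k := k) (P := P) (D := D) (a s') = xmon k P (ea s')) (hb : ∀ j', theta (k := k) (P := P) (D := D) (b j') = xmon k P (eb j'))
    (w : Word d' r') :
    theta (k := k) (P := P) (D := D) ((∏ s', a s' ^ w.wp s') * ∏ j', b j' ^ w.wm j') =
      xmon k P (fun t => (fsum d' fun s' => w.wp s' * ea s' t) + fsum r' fun j' => w.wm j' * eb j' t) := by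
  rw [map_mul, map_prod, map_prod]
  simp only [map_pow, ha, hb]
  rw [prod_xmon_pow, prod_xmon_pow, ← xmon_add]
  congr 1
  funext t
  simp only [Pi.add_apply, Finset.sum_apply, Pi.smul_apply, smul_eq_mul, fsum_eq_sum]

/-! ## §4 Exponent-vector identities in `ℤ^{Fin d ⊕ P}` -/

/-- `Σ ne_t e_t = Σ (ne_t − K g₀_t) e_t + K · Σ g₀_t e_t`. [folklore] -/
theorem sum_nsmul_single_eq {d : ℕ} (P : Type) (ne g₀ : Fin d → ℕ) (K : ℕ) :
    (∑ t : Fin d, ne t • Finsupp.single (Sum.inl t : Fin d ⊕ P) (1 : ℤ)) =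
      (∑ t : Fin d, ((ne t : ℤ) - K * g₀ t) • Finsupp.single (Sum.inl t : Fin d ⊕ P) (1 : ℤ)) +
        K • ∑ t : Fin d, g₀ t • Finsupp.single (Sum.inl t : Fin d ⊕ P) (1 : ℤ) := by
  rw [Finset.smul_sum, ← Finset.sum_add_distrib]
  refine Finset.sum_congr rfl fun t _ => ?_
  rw [← natCast_zsmul, ← natCast_zsmul _ (g₀ t), ← natCast_zsmul, smul_smul, ← add_smul]
  congr 1
  ring

/-- `Σ_s mx_s · (Σ_t ELL t s · e_t) = Σ_t (Σ_s ELL t s · mx_s) · e_t`. [folklore] -/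
theorem sum_nsmul_sum_zsmul_single {d d' : ℕ} (P : Type) (mx : Fin d' → ℕ) (ELL : Fin d → Fin d' → ℤ) :
    (∑ s : Fin d', mx s • ∑ t : Fin d, ELL t s • Finsupp.single (Sum.inl t : Fin d ⊕ P) (1 : ℤ)) =
      ∑ t : Fin d, (∑ s : Fin d', ELL t s * (mx s : ℤ)) • Finsupp.single (Sum.inl t : Fin d ⊕ P) (1 : ℤ) := by
  simp only [Finset.smul_sum]
  rw [Finset.sum_comm]
  refine Finset.sum_congr rfl fun t _ => ?_
  simp only [← natCast_zsmul, smul_smul]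
  rw [← Finset.sum_smul]
  congr 1
  exact Finset.sum_congr rfl fun _ _ => mul_comm _ _

/-! ## §5 Injectivity of the lattice map -/

/-- ★ The lattice map `ℤ^{Fin d′ ⊕ P} → ℤ^{Fin d ⊕ P}`, `e′_{s′} ↦ Σ_t ELL t s′ · e_t`, `e′_p ↦ e_p`, is injective as soon as an integer matrix `Binv` with
`Binv · ELL = det · 1`, `det ≠ 0`, is given (proof by the coordinate functionals `x ↦ Σ_t Binv u′ t · x_{t}` and `x ↦ x_p`). [folklore] -/
theorem linearCombination_img_injective {d d' : ℕ} (ELL : Fin d → Fin d' → ℤ) (det : ℤ) (Binv : Fin d' → Fin d → ℤ) (hdet : det ≠ 0)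
    (hBinv : ∀ s' u' : Fin d', (fsum d fun t => Binv s' t * ELL t u') = if s' = u' then det else 0) :
    Function.Injective (Finsupp.linearCombination ℤ (M := (Fin d ⊕ P) →₀ ℤ) (α := Fin d' ⊕ P)
      (Sum.elim (fun s' => ∑ t : Fin d, ELL t s' • Finsupp.single (Sum.inl t : Fin d ⊕ P) (1 : ℤ)) (fun p => Finsupp.single (Sum.inr p) 1))) := by
  classical
  -- notation
  let img : Fin d' ⊕ P → ((Fin d ⊕ P) →₀ ℤ) := Sum.elim (fun s' => ∑ t : Fin d, ELL t s' • Finsupp.single (Sum.inl t) (1 : ℤ)) (fun p => Finsupp.single (Sum.inr p) 1)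
  let ℓ' : ((Fin d' ⊕ P) →₀ ℤ) →ₗ[ℤ] ((Fin d ⊕ P) →₀ ℤ) := Finsupp.linearCombination ℤ img
  change Function.Injective ℓ'
  have hℓ' : ∀ f : (Fin d' ⊕ P) →₀ ℤ, ℓ' f = f.sum fun w n => n • img w := fun f => by simp [ℓ', Finsupp.linearCombination_apply]
  have hcoord : ∀ (χ : ((Fin d ⊕ P) →₀ ℤ) →+ ℤ) (w₀ : Fin d' ⊕ P) (c₀ : ℤ), (∀ w, χ (img w) = if w = w₀ then c₀ else 0) →
      ∀ f : (Fin d' ⊕ P) →₀ ℤ, χ (ℓ' f) = c₀ * f w₀ := by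
    intro χ w₀ c₀ hχ f
    rw [hℓ', map_finsuppSum]
    simp only [map_zsmul, smul_eq_mul, hχ, mul_ite, mul_zero]
    rw [Finsupp.sum, Finset.sum_ite_eq']
    split_ifs with hmem
    · ring
    · rw [Finsupp.notMem_support_iff.mp hmem, mul_zero]
  have himg_inl : ∀ s' (u : Fin d), (img (Sum.inl s')) (Sum.inl u) = ELL u s' := by
    intro s' u
    change (∑ t : Fin d, ELL t s' • Finsupp.single (Sum.inl t : Fin d ⊕ P) (1 : ℤ)) (Sum.inl u) = _
    rw [Finsupp.finsetSum_apply]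
    simp only [Finsupp.smul_apply, Finsupp.single_apply, smul_eq_mul, mul_ite, mul_one, mul_zero, Sum.inl.injEq]
    rw [Finset.sum_ite_eq']
    simp
  have himg_inl_inr : ∀ s' (p : P), (img (Sum.inl s')) (Sum.inr p) = 0 := by
    intro s' p
    change (∑ t : Fin d, ELL t s' • Finsupp.single (Sum.inl t : Fin d ⊕ P) (1 : ℤ)) (Sum.inr p) = _
    rw [Finsupp.finsetSum_apply]
    simp
  intro f f' h
  ext w
  rcases w with u' | p
  · let χ : ((Fin d ⊕ P) →₀ ℤ) →+ ℤ :=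
      { toFun := fun x => ∑ t : Fin d, Binv u' t * x (Sum.inl t)
        map_zero' := by simp
        map_add' := fun x y => by simp only [Finsupp.add_apply, mul_add, Finset.sum_add_distrib] }
    have hχ : ∀ w, χ (img w) = if w = Sum.inl u' then det else 0 := by
      rintro (s' | p)
      · change (∑ t : Fin d, Binv u' t * (img (Sum.inl s')) (Sum.inl t)) = _
        simp only [himg_inl]
        have h4 := hBinv u' s'
        rw [fsum_eq_sum] at h4
        rw [h4]
        by_cases h' : u' = s'
        · subst h'; simp
        · rw [if_neg h', if_neg (fun h'' => h' (Sum.inl_injective h'').symm)]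
      · change (∑ t : Fin d, Binv u' t * (Finsupp.single (Sum.inr p : Fin d ⊕ P) (1 : ℤ)) (Sum.inl t)) = _
        simp
    have h1 := hcoord χ (Sum.inl u') det hχ f
    have h2 := hcoord χ (Sum.inl u') det hχ f'
    have h12 : det * f (Sum.inl u') = det * f' (Sum.inl u') := by rw [← h1, ← h2, h]
    exact mul_left_cancel₀ hdet h12
  · let χ : ((Fin d ⊕ P) →₀ ℤ) →+ ℤ := Finsupp.applyAddHom (Sum.inr p)
    have hχ : ∀ w, χ (img w) = if w = Sum.inr p then 1 else 0 := by
      rintro (s' | p')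
      · change (img (Sum.inl s')) (Sum.inr p) = _
        rw [himg_inl_inr]; simp
      · change (Finsupp.single (Sum.inr p' : Fin d ⊕ P) (1 : ℤ)) (Sum.inr p) = _
        by_cases h' : p' = p
        · subst h'; simp
        · have hne : (Sum.inr p' : Fin d ⊕ P) ≠ Sum.inr p := fun h'' => h' (Sum.inr_injective h'')
          have hne' : (Sum.inr p' : Fin d' ⊕ P) ≠ Sum.inr p := fun h'' => h' (Sum.inr_injective h'')
          rw [Finsupp.single_eq_of_ne hne.symm, if_neg hne']
    have h1 := hcoord χ (Sum.inr p) 1 hχ f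
    have h2 := hcoord χ (Sum.inr p) 1 hχ f'
    have h12 : (1 : ℤ) * f (Sum.inr p) = 1 * f' (Sum.inr p) := by rw [← h1, ← h2, h]
    simpa using h12

end Summit.ResolutionOfSingularities.ResolutionOfSingularities.Theorems.FInjectiveMacaulayfication.ToricChartPresentation

end
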